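import Summits.BirchSwinnertonDyer.BirchSwinnertonDyer.Theorems.ManinLocalTwoThreePinningTwoSixteenStagesA
import HarnessLib

/-!
# Level 216 by the PINNING KERNEL IN `S₂` — staged sieve certificates (part 5 of 10)

Cell `bsd-f2-manin`, route `ManinLocalTwoThree`, crux C2 `ManinOddAtFour` (stmt-BirchSwinnertonDyer-22967), an g56;
`--supports stmt-BirchSwinnertonDyer-22967` (helper).  The kernel certificates `hst4c7` … `hst4c13` (stage 4) of the staged box sieve
of level 216 (stage `k` maps the live list `L_k` of `…PinningTwoSixteenTables` into `L_{k+1}`; large stages in chunks of at most `EXTCAP = 96`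
extensions, glued by part D's `sieveStep_subset_of_chunks`), split off the main file so that every file stays inside the farm's per-file
budget (depth `K = 144`: at `2³·3³ ∣ N` every column with `(n, 6) > 1` is dead, so the sieve needs twice the usual depth and ~1.2·10⁶ kernel
units in all).  Next = `…PinningTwoSixteenStagesC`; the last part `…PinningTwoSixteen` has the duals, the cover `hcover` (from `hst0 … hst11`), the Fricke sieve, `dim S₂` and the pinning theorems.
HONEST FRAMING: kernel-checked evaluations of integer lists only; nothing here proves C2/C3, Manin's conjecture or BSD.
[cite: CremonaAlgorithms1997, §2.10] [cite: Koehler2011, §2.1]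
-/


set_option autoImplicit false
-- lint-debt: the directory name repeats the summit name (sibling precedent `ManinLocalTwoThreePinningSixtyThree.lean`)
set_option linter.dupNamespace false

noncomputable section


open Complex
open UpperHalfPlane hiding I
open scoped MatrixGroups ModularForm
open ModularForm CongruenceSubgroup
open Literature.NumberTheory.ModularForms
open Literature.NumberTheory.EllipticCurves Literature.NumberTheory.EllipticCurves.ModularForms

namespace Summit.BirchSwinnertonDyer.BirchSwinnertonDyer.Theorems.ManinLocalTwoThree.PinningTwoSixteen

open Summit.BirchSwinnertonDyer.BirchSwinnertonDyer.Theorems.ManinLocalTwoThree.BracketSturm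
open Summit.BirchSwinnertonDyer.BirchSwinnertonDyer.Theorems.ManinLocalTwoThree.PinningKernel


set_option maxHeartbeats 4000000
set_option maxRecDepth 16384

/-! ## §2d-2 Sieve certificates `hst4c7` … `hst4c13` (stage 4) -/

/-- Sieve stage `4`, chunk `7` (kernel `decide`). [folklore] -/
theorem hst4c7 : ∀ σ ∈ sieveStep 216 144 (chunks4.getD 7 []) (stages.getD 4 (0, [])), σ ∈ lvs.getD 4 [] := by decide +kernel
/-- Sieve stage `4`, chunk `8` (kernel `decide`). [folklore] -/
theorem hst4c8 : ∀ σ ∈ sieveStep 216 144 (chunks4.getD 8 []) (stages.getD 4 (0, [])), σ ∈ lvs.getD 4 [] := by decide +kernel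
/-- Sieve stage `4`, chunk `9` (kernel `decide`). [folklore] -/
theorem hst4c9 : ∀ σ ∈ sieveStep 216 144 (chunks4.getD 9 []) (stages.getD 4 (0, [])), σ ∈ lvs.getD 4 [] := by decide +kernel
/-- Sieve stage `4`, chunk `10` (kernel `decide`). [folklore] -/
theorem hst4c10 : ∀ σ ∈ sieveStep 216 144 (chunks4.getD 10 []) (stages.getD 4 (0, [])), σ ∈ lvs.getD 4 [] := by decide +kernel
/-- Sieve stage `4`, chunk `11` (kernel `decide`). [folklore] -/
theorem hst4c11 : ∀ σ ∈ sieveStep 216 144 (chunks4.getD 11 []) (stages.getD 4 (0, [])), σ ∈ lvs.getD 4 [] := by decide +kernel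
/-- Sieve stage `4`, chunk `12` (kernel `decide`). [folklore] -/
theorem hst4c12 : ∀ σ ∈ sieveStep 216 144 (chunks4.getD 12 []) (stages.getD 4 (0, [])), σ ∈ lvs.getD 4 [] := by decide +kernel
/-- Sieve stage `4`, chunk `13` (kernel `decide`). [folklore] -/
theorem hst4c13 : ∀ σ ∈ sieveStep 216 144 (chunks4.getD 13 []) (stages.getD 4 (0, [])), σ ∈ lvs.getD 4 [] := by decide +kernel

end Summit.BirchSwinnertonDyer.BirchSwinnertonDyer.Theorems.ManinLocalTwoThree.PinningTwoSixteen

end
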